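import Literature.Geometry.Riemannian.RicciFlowCurvatureBlowupJunction
import Literature.Geometry.Lorentzian.CoordCurvatureNormSq
import HarnessLib

/-!
# The square norm of the curvature tensor of a metric on a manifold
(topic `Geometry/Riemannian`)

Manifold-level companion of `Lorentzian/CoordCurvatureNormSq.lean`, towards Topping's curvature
doubling estimate (Topping 2006, Thm. 3.2.11, the hypothesis `h₁` of
`ricciFlow_curvature_blowup_of_shortTime_of_thm3211_of_claim`): the function `u = |Rm|²` to
which the weak maximum principle is applied in the printed proof (p. 37).

* `PseudoRiemannianMetric.curvNormSqWith g cov x = |Rm|²_g(x)` — the full contraction of the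
  curvature tensor of the connection `cov` with respect to `g`, defined intrinsically as
  `−tr_g tr_g tr(R(X,Y) ∘ R(X',Y'))` (`R = cov.curvature x`; Topping 2006, §2.1 and (3.2.4):
  `|Rm|² = g^{ij}g^{kl}g^{ab}g^{cd}R_{ikac}R_{jlbd}`), through the auxiliary bilinear forms
  `curvPairForm`, `curvInnerForm`;
* **chart dictionary**: `OpensChart.curvNormSqWith_eq_rmNormSqAt` (on `U : Opens E` the function is
  the coordinate `rmNormSqAt` of the components), `curvNormSqWith_chartPullback` (naturality under
  the inverse chart, from `riemann_comap_apply` and `trace_chartPullback_eq`) and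
  `curvNormSqWith_chartInv_eq` — along a family with Levi-Civita witnesses,
  `|Rm|²_{g t}(Φ y) = rmNormSqAt (chartRep I g x₀ t) y`;
* consequences, read in the chart at the point: `curvNormSqWith_nonneg`;
  **frame comparison with `CurvatureBoundedBy`** (`RicciFlowMaximal.lean`):
  `curvNormSqWith_le_of_curvatureBoundedBy` (`|Rm|² ≤ n⁴K²`) and
  `curvatureBoundedBy_of_curvNormSqWith_le` (`|Rm|² ≤ c` everywhere gives the frame bound `√c`) —
  Topping 2006, p. 37: `|Rm|` is comparable to the largest sectional curvature;
* `IsRicciFlow.contMDiffOn_curvNormSqWith` — along a Ricci flow on `[0, T]`,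
  `(x, t) ↦ |Rm|²(x, t)` is `C^∞` on `M × [0, T]` as soon as its chart representatives
  `rmNormSqAt (chartRep I g z t) y` are jointly `C^∞` (which `CoordCurvatureNormEvolution.lean`
  provides for `T > 0`; Topping 2006, §1.2.3), through the charts.

Everything is proved; the definitions are explicit (no `Prop` facts).

## References

* P. Topping, *Lectures on the Ricci flow*, LMS Lecture Note Series 325, CUP 2006, §1.2.3, §2.1,
  §3.2, Prop. 3.2.10–Thm. 3.2.11 and (3.2.4) (p. 37). [Topping2006]
* B. O'Neill, *Semi-Riemannian geometry with applications to relativity*, Academic Press 1983,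
  Ch. 3, Prop. 3.59 (naturality), pp. 60–61 (metric contraction). [ONeill1983]
-/

noncomputable section

set_option maxSynthPendingDepth 3

open Bundle Set Filter Module Function TopologicalSpace
open scoped Manifold ContDiff Topology

namespace Literature.Geometry.Riemannian

open Lorentzian Lorentzian.PseudoRiemannianMetric

/-! ### The definition -/

section Definition

variable {E : Type*} [NormedAddCommGroup E] [NormedSpace ℝ E]
  {H : Type*} [TopologicalSpace H] {I : ModelWithCorners ℝ E H}
  {M : Type*} [TopologicalSpace M] [ChartedSpace H M] [IsManifold I ∞ M]
  (g : PseudoRiemannianMetric I ∞ E (TangentSpace I : M → Type _))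
  (cov : CovariantDerivative I E (TangentSpace I : M → Type _))

/-- The bilinear form `(Y, Y') ↦ tr(R(X,Y) ∘ R(X',Y'))` on `T_x M` (`R = cov.curvature x`).
[cite: Topping2006, §2.1] -/
def _root_.Literature.Geometry.Lorentzian.CovariantDerivative.curvPairForm (x : M)
    (X X' : TangentSpace I x) : LinearMap.BilinForm ℝ (TangentSpace I x) :=
  LinearMap.mk₂ ℝ
    (fun Y Y' ↦ LinearMap.trace ℝ (TangentSpace I x)
      ((cov.curvature x X Y : TangentSpace I x →L[ℝ] TangentSpace I x).toLinearMap ∘ₗ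
        (cov.curvature x X' Y' : TangentSpace I x →L[ℝ] TangentSpace I x).toLinearMap))
    (fun Y₁ Y₂ Y' ↦ by simp only [map_add, ContinuousLinearMap.toLinearMap_add, LinearMap.add_comp])
    (fun c Y Y' ↦ by simp only [map_smul, ContinuousLinearMap.toLinearMap_smul, LinearMap.smul_comp,
      smul_eq_mul])
    (fun Y Y₁ Y₂ ↦ by simp only [map_add, ContinuousLinearMap.toLinearMap_add, LinearMap.comp_add])
    (fun c Y Y' ↦ by simp only [map_smul, ContinuousLinearMap.toLinearMap_smul, LinearMap.comp_smul,
      smul_eq_mul])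

/-- Unfolding lemma for `curvPairForm`. [folklore] -/
@[simp]
theorem _root_.Literature.Geometry.Lorentzian.CovariantDerivative.curvPairForm_apply (x : M)
    (X X' Y Y' : TangentSpace I x) :
    cov.curvPairForm x X X' Y Y' = LinearMap.trace ℝ (TangentSpace I x)
        ((cov.curvature x X Y : TangentSpace I x →L[ℝ] TangentSpace I x).toLinearMap ∘ₗ
          (cov.curvature x X' Y' : TangentSpace I x →L[ℝ] TangentSpace I x).toLinearMap) := rfl

/-- `curvPairForm` is additive in `X`. [folklore] -/
theorem _root_.Literature.Geometry.Lorentzian.CovariantDerivative.curvPairForm_add_left (x : M)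
    (X₁ X₂ X' : TangentSpace I x) :
    cov.curvPairForm x (X₁ + X₂) X' = cov.curvPairForm x X₁ X' + cov.curvPairForm x X₂ X' := by
  ext Y Y'
  simp only [CovariantDerivative.curvPairForm_apply, map_add, _root_.add_apply,
    ContinuousLinearMap.toLinearMap_add, LinearMap.add_comp, LinearMap.add_apply]

/-- `curvPairForm` is homogeneous in `X`. [folklore] -/
theorem _root_.Literature.Geometry.Lorentzian.CovariantDerivative.curvPairForm_smul_left (x : M)
    (c : ℝ) (X X' : TangentSpace I x) :
    cov.curvPairForm x (c • X) X' = c • cov.curvPairForm x X X' := by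
  ext Y Y'
  simp only [CovariantDerivative.curvPairForm_apply, map_smul, _root_.smul_apply,
    ContinuousLinearMap.toLinearMap_smul, LinearMap.smul_comp, LinearMap.smul_apply, smul_eq_mul]

/-- `curvPairForm` is additive in `X'`. [folklore] -/
theorem _root_.Literature.Geometry.Lorentzian.CovariantDerivative.curvPairForm_add_right (x : M)
    (X X₁ X₂ : TangentSpace I x) :
    cov.curvPairForm x X (X₁ + X₂) = cov.curvPairForm x X X₁ + cov.curvPairForm x X X₂ := by
  ext Y Y'
  simp only [CovariantDerivative.curvPairForm_apply, map_add, _root_.add_apply,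
    ContinuousLinearMap.toLinearMap_add, LinearMap.comp_add, LinearMap.add_apply]

/-- `curvPairForm` is homogeneous in `X'`. [folklore] -/
theorem _root_.Literature.Geometry.Lorentzian.CovariantDerivative.curvPairForm_smul_right (x : M)
    (c : ℝ) (X X' : TangentSpace I x) :
    cov.curvPairForm x X (c • X') = c • cov.curvPairForm x X X' := by
  ext Y Y'
  simp only [CovariantDerivative.curvPairForm_apply, map_smul, _root_.smul_apply,
    ContinuousLinearMap.toLinearMap_smul, LinearMap.comp_smul, LinearMap.smul_apply, smul_eq_mul]

variable [FiniteDimensional ℝ E]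

/-- The metric trace is additive. [folklore] -/
theorem _root_.Literature.Geometry.Lorentzian.PseudoRiemannianMetric.trace_add' (x : M)
    (B₁ B₂ : LinearMap.BilinForm ℝ (TangentSpace I x)) :
    g.trace x (B₁ + B₂) = g.trace x B₁ + g.trace x B₂ := by
  simp only [PseudoRiemannianMetric.trace, LinearMap.comp_add, map_add]

/-- The metric trace is homogeneous. [folklore] -/
theorem _root_.Literature.Geometry.Lorentzian.PseudoRiemannianMetric.trace_smul' (x : M) (c : ℝ)
    (B : LinearMap.BilinForm ℝ (TangentSpace I x)) :
    g.trace x (c • B) = c * g.trace x B := by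
  simp only [PseudoRiemannianMetric.trace, LinearMap.comp_smul, map_smul, smul_eq_mul]

/-- The bilinear form `(X, X') ↦ tr_g [(Y,Y') ↦ tr(R(X,Y) ∘ R(X',Y'))]` on `T_x M`.
[cite: Topping2006, §2.1] -/
def _root_.Literature.Geometry.Lorentzian.PseudoRiemannianMetric.curvInnerForm (x : M) :
    LinearMap.BilinForm ℝ (TangentSpace I x) :=
  LinearMap.mk₂ ℝ (fun X X' ↦ g.trace x (cov.curvPairForm x X X'))
    (fun X₁ X₂ X' ↦ by rw [CovariantDerivative.curvPairForm_add_left, g.trace_add'])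
    (fun c X X' ↦ by rw [CovariantDerivative.curvPairForm_smul_left, g.trace_smul', smul_eq_mul])
    (fun X X₁ X₂ ↦ by rw [CovariantDerivative.curvPairForm_add_right, g.trace_add'])
    (fun c X X' ↦ by rw [CovariantDerivative.curvPairForm_smul_right, g.trace_smul', smul_eq_mul])

/-- Unfolding lemma for `curvInnerForm`. [folklore] -/
@[simp]
theorem _root_.Literature.Geometry.Lorentzian.PseudoRiemannianMetric.curvInnerForm_apply (x : M)
    (X X' : TangentSpace I x) :
    g.curvInnerForm cov x X X' = g.trace x (cov.curvPairForm x X X') := rfl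

/-- **The square norm of the curvature tensor** of the connection `cov` with respect to the
metric `g` at `x`: `|Rm|²_g(x) = −tr_g tr_g tr(R(X,Y) ∘ R(X',Y'))` (contracting `X` with `X'`
and `Y` with `Y'`; `R = cov.curvature x`). For a Riemannian metric and a metric connection this is
the full contraction `g^{ij}g^{kl}g^{ab}g^{cd}R_{ikac}R_{jlbd} = Σ_{acij} Rm(e_a,e_c,e_i,e_j)²`
(Topping 2006, (3.2.4); in a chart it is the coordinate `MetricCoord.rmNormSqAt`,
`curvNormSqWith_chartInv_eq`, whose frame formula is `rmNormSqAt_eq_sum_sq`).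
[cite: Topping2006, §3.2, (3.2.4)] -/
def _root_.Literature.Geometry.Lorentzian.PseudoRiemannianMetric.curvNormSqWith (x : M) : ℝ :=
  -g.trace x (g.curvInnerForm cov x)

/-- The square norm of the curvature only depends on the curvature endomorphisms at the point.
[folklore] -/
theorem _root_.Literature.Geometry.Lorentzian.PseudoRiemannianMetric.curvNormSqWith_congr
    {cov cov' : CovariantDerivative I E (TangentSpace I : M → Type _)} {x : M}
    (h : cov.curvature x = cov'.curvature x) : g.curvNormSqWith cov x = g.curvNormSqWith cov' x := by
  simp only [PseudoRiemannianMetric.curvNormSqWith]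
  congr 1
  congr 1
  ext X X'
  simp only [PseudoRiemannianMetric.curvInnerForm_apply]
  congr 1
  ext Y Y'
  simp only [CovariantDerivative.curvPairForm_apply, h]

end Definition

/-! ### The chart dictionary -/

section Opens

variable {E : Type*} [NormedAddCommGroup E] [NormedSpace ℝ E] [FiniteDimensional ℝ E]
  [CompleteSpace E] {U : Opens E}
  {g : PseudoRiemannianMetric 𝓘(ℝ, E) ∞ E (TangentSpace 𝓘(ℝ, E) : U → Type _)}
  {G : E → E →L[ℝ] E →L[ℝ] ℝ} (hG : ∀ y : U, g.val y = G y)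
include hG

/-- **On an open subset of the model space, `|Rm|²` of the Levi-Civita connection is the
coordinate `rmNormSqAt` of the components** (`riemann_eq_riemAt`, `trace_eq_mtrAt`).
[cite: ONeill1983, Ch. 3, Lemma 3.38] -/
theorem _root_.Literature.Geometry.Lorentzian.OpensChart.curvNormSqWith_eq_rmNormSqAt
    [g.HasLeviCivita] (u : U) :
    g.curvNormSqWith g.leviCivita u = MetricCoord.rmNormSqAt G u := by
  rw [PseudoRiemannianMetric.curvNormSqWith, MetricCoord.rmNormSqAt]
  congr 1
  refine OpensChart.trace_eq_mtrAt hG u _ _ fun X X' ↦ ?_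
  change g.trace u (g.leviCivita.curvPairForm u X X') = MetricCoord.mtrAt G u (MetricCoord.rmPair G u X X')
  refine OpensChart.trace_eq_mtrAt hG u _ _ fun Y Y' ↦ ?_
  have hR : ∀ A B : E, (g.leviCivita.curvature u A B : E →L[ℝ] E) = MetricCoord.riemAt G u A B := by
    intro A B
    ext Z
    exact OpensChart.riemann_eq_riemAt hG u A B Z
  change LinearMap.trace ℝ E ((g.leviCivita.curvature u X Y : E →L[ℝ] E).toLinearMap ∘ₗ
      (g.leviCivita.curvature u X' Y' : E →L[ℝ] E).toLinearMap) =
    MetricCoord.traceCLM E ((MetricCoord.riemAt G u X Y).comp (MetricCoord.riemAt G u X' Y'))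
  rw [hR, hR]
  rfl

end Opens

section Chart

variable {E : Type*} [NormedAddCommGroup E] [NormedSpace ℝ E] [FiniteDimensional ℝ E]
  [CompleteSpace E] {H : Type*} [TopologicalSpace H] {I : ModelWithCorners ℝ E H} [I.Boundaryless]
  {M : Type*} [TopologicalSpace M] [ChartedSpace H M] [IsManifold I ∞ M]

/-- Trace invariance under conjugation by an invertible continuous linear map between fibres:
`tr(L⁻¹ A L ∘ L⁻¹ B L) = tr(A B)`. [folklore] -/
theorem trace_conj_comp {F F' : Type*} [AddCommGroup F] [Module ℝ F] [AddCommGroup F'] [Module ℝ F']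
    [TopologicalSpace F] [TopologicalSpace F'] [Module.Finite ℝ F] [Module.Free ℝ F]
    [Module.Finite ℝ F'] [Module.Free ℝ F']
    (L : F' →L[ℝ] F) (hL : L.IsInvertible) (A B : F →ₗ[ℝ] F) :
    LinearMap.trace ℝ F' (((L.inverse : F →L[ℝ] F').toLinearMap ∘ₗ A ∘ₗ L.toLinearMap) ∘ₗ
        ((L.inverse : F →L[ℝ] F').toLinearMap ∘ₗ B ∘ₗ L.toLinearMap)) =
      LinearMap.trace ℝ F (A ∘ₗ B) := by
  have hassoc : ((L.inverse : F →L[ℝ] F').toLinearMap ∘ₗ A ∘ₗ L.toLinearMap) ∘ₗ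
      ((L.inverse : F →L[ℝ] F').toLinearMap ∘ₗ B ∘ₗ L.toLinearMap) =
      (L.inverse : F →L[ℝ] F').toLinearMap ∘ₗ ((A ∘ₗ B) ∘ₗ L.toLinearMap) := by
    ext v
    simp only [LinearMap.comp_apply, ContinuousLinearMap.coe_coe, hL.self_apply_inverse]
  have h2 : ((A ∘ₗ B) ∘ₗ L.toLinearMap) ∘ₗ (L.inverse : F →L[ℝ] F').toLinearMap = A ∘ₗ B := by
    ext v
    simp only [LinearMap.comp_apply, ContinuousLinearMap.coe_coe, hL.self_apply_inverse]
  rw [hassoc, LinearMap.trace_comp_comm', h2]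

/-- **Naturality of `|Rm|²` under the inverse chart**: with `Φ = chartInv I x₁` and the pulled-back
metric `Φ^*g = chartPullback I g x₁` on the chart target,
`|Rm|²_{Φ^*g}(u) = |Rm|²_g(Φ u)` (curvature: `riemann_comap_apply`; traces: `trace_chartPullback_eq`).
[cite: ONeill1983, Ch. 3, Prop. 3.59] -/
theorem curvNormSqWith_chartPullback (g : PseudoRiemannianMetric I ∞ E (TangentSpace I : M → Type _))
    (x₁ : M) (u : chartTarget I x₁) :
    haveI := g.hasLeviCivita
    haveI := (chartPullback I g x₁).hasLeviCivita
    (chartPullback I g x₁).curvNormSqWith (chartPullback I g x₁).leviCivita u =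
      g.curvNormSqWith g.leviCivita (chartInv I x₁ u) := by
  haveI := g.hasLeviCivita
  haveI := (chartPullback I g x₁).hasLeviCivita
  haveI : FiniteDimensional ℝ (TangentSpace I (chartInv I x₁ u)) :=
    inferInstanceAs (FiniteDimensional ℝ E)
  haveI : FiniteDimensional ℝ (TangentSpace 𝓘(ℝ, E) u) := inferInstanceAs (FiniteDimensional ℝ E)
  set L := mfderiv 𝓘(ℝ, E) I (chartInv I x₁) u with hL
  have hLi : L.IsInvertible := isInvertible_mfderiv_of_injective rfl (injective_mfderiv_chartInv x₁ u)
  have hR : ∀ X Y Z : E, (chartPullback I g x₁).riemann u X Y Z =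
      L.inverse (g.riemann (chartInv I x₁ u) (L X) (L Y) (L Z)) := fun X Y Z ↦
    g.riemann_comap_apply contMDiff_pullbackBilin_holds (contMDiff_chartInv x₁)
      (injective_mfderiv_chartInv x₁) rfl u X Y Z
  rw [PseudoRiemannianMetric.curvNormSqWith, PseudoRiemannianMetric.curvNormSqWith]
  congr 1
  refine trace_chartPullback_eq g x₁ u _ _ fun X X' ↦ ?_
  rw [PseudoRiemannianMetric.curvInnerForm_apply, PseudoRiemannianMetric.curvInnerForm_apply]
  refine trace_chartPullback_eq g x₁ u _ _ fun Y Y' ↦ ?_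
  rw [CovariantDerivative.curvPairForm_apply, CovariantDerivative.curvPairForm_apply]
  have hRL : ∀ X Y : E, ((chartPullback I g x₁).leviCivita.curvature u X Y : E →L[ℝ] E).toLinearMap =
      (L.inverse : _ →L[ℝ] E).toLinearMap ∘ₗ
        (g.leviCivita.curvature (chartInv I x₁ u) (L X) (L Y) : _ →L[ℝ] _).toLinearMap ∘ₗ
          L.toLinearMap := by
    intro X Y
    ext Z
    exact hR X Y Z
  rw [hRL, hRL]
  exact trace_conj_comp L hLi _ _

/-- **`|Rm|²` of a family read in the chart**: for Levi-Civita witnesses `cov t` of `g t`,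
`|Rm|²_{g t, cov t}(Φ y) = rmNormSqAt (chartRep I g x₀ t) y` on the chart target
(`curvature_eq_riemann`, `curvNormSqWith_chartPullback`, `OpensChart.curvNormSqWith_eq_rmNormSqAt`).
[cite: Topping2006, §3.2, (3.2.4)] -/
theorem curvNormSqWith_chartInv_eq {g : ℝ → PseudoRiemannianMetric I ∞ E (TangentSpace I : M → Type _)}
    {cov : ℝ → CovariantDerivative I E (TangentSpace I : M → Type _)} {t : ℝ}
    (hLC : (g t).IsLeviCivita (cov t)) (x₀ : M) (y : chartTarget I x₀) :
    (g t).curvNormSqWith (cov t) (chartInv I x₀ y) = MetricCoord.rmNormSqAt (chartRep I g x₀ t) y := by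
  haveI := (g t).hasLeviCivita
  haveI := (chartPullback I (g t) x₀).hasLeviCivita
  have h2 : (2 : ℕ∞ω) ≤ ∞ := WithTop.coe_le_coe.mpr le_top
  rw [(g t).curvNormSqWith_congr (hLC.curvature_eq_riemann h2 (chartInv I x₀ y)),
    ← curvNormSqWith_chartPullback (g t) x₀ y,
    OpensChart.curvNormSqWith_eq_rmNormSqAt (val_chartPullback_eq_chartRep g x₀ t) y]

/-- The single-metric form of `curvNormSqWith_chartInv_eq` (constant family). [folklore] -/
theorem curvNormSqWith_chartInv_eq' {g : PseudoRiemannianMetric I ∞ E (TangentSpace I : M → Type _)}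
    {cov : CovariantDerivative I E (TangentSpace I : M → Type _)} (hLC : g.IsLeviCivita cov)
    (x₀ : M) (y : chartTarget I x₀) :
    g.curvNormSqWith cov (chartInv I x₀ y) = MetricCoord.rmNormSqAt (chartRep I (fun _ ↦ g) x₀ 0) y :=
  curvNormSqWith_chartInv_eq (g := fun _ ↦ g) (cov := fun _ ↦ cov) (t := 0) hLC x₀ y

end Chart

/-! ### Consequences read in the chart at the point: sign and frame comparison -/

section Pointwise

variable {E : Type*} [NormedAddCommGroup E] [NormedSpace ℝ E] [FiniteDimensional ℝ E]
  [CompleteSpace E] {H : Type*} [TopologicalSpace H] {I : ModelWithCorners ℝ E H} [I.Boundaryless]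
  {M : Type*} [TopologicalSpace M] [ChartedSpace H M] [IsManifold I ∞ M]
  {g : PseudoRiemannianMetric I ∞ E (TangentSpace I : M → Type _)}
  {cov : CovariantDerivative I E (TangentSpace I : M → Type _)}

omit [CompleteSpace E] in
/-- The chart components of a single metric at `x₀` form coordinate metric components on the chart
target (`OpensChart.isMetricOn_repr`). [folklore] -/
theorem isMetricOn_chartRep_const (g : PseudoRiemannianMetric I ∞ E (TangentSpace I : M → Type _))
    (x₀ : M) :
    MetricCoord.IsMetricOn (chartRep I (fun _ ↦ g) x₀ 0) (extChartAt I x₀).target :=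
  Lorentzian.OpensChart.isMetricOn_repr (val_chartPullback_eq_chartRep (fun _ ↦ g) x₀ 0)

omit [CompleteSpace E] in
/-- The chart components of a Riemannian metric are positive definite. [folklore] -/
theorem chartRep_const_pos (hR : g.IsRiemannian) (x₀ : M) (y : chartTarget I x₀) (v : E) (hv : v ≠ 0) :
    0 < chartRep I (fun _ ↦ g) x₀ 0 y v v := by
  rw [chartRep_apply]
  exact chartPullback_pos g x₀ y (fun w hw ↦ hR _ w hw) v hv

omit [CompleteSpace E] in
/-- The chart components are symmetric. [folklore] -/
theorem chartRep_const_symm (x₀ : M) (y : chartTarget I x₀) (v w : E) :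
    chartRep I (fun _ ↦ g) x₀ 0 y v w = chartRep I (fun _ ↦ g) x₀ 0 y w v :=
  (isMetricOn_chartRep_const g x₀).symm y y.2 v w

/-- The curvature form of `(g, cov)` read in the chart at `x₀`:
`G_y(R_G(v,w)z, w') = Rm_{Φ y}(dΦ v, dΦ w, dΦ z, dΦ w')`. [cite: ONeill1983, Ch. 3, Prop. 3.59] -/
theorem chartRep_riemAt_eq_curvatureForm (hLC : g.IsLeviCivita cov) (x₀ : M) (y : chartTarget I x₀)
    (v w z w' : E) :
    chartRep I (fun _ ↦ g) x₀ 0 y (MetricCoord.riemAt (chartRep I (fun _ ↦ g) x₀ 0) y v w z) w' =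
      g.curvatureForm cov (chartInv I x₀ y) (mfderiv 𝓘(ℝ, E) I (chartInv I x₀) y v)
        (mfderiv 𝓘(ℝ, E) I (chartInv I x₀) y w) (mfderiv 𝓘(ℝ, E) I (chartInv I x₀) y z)
        (mfderiv 𝓘(ℝ, E) I (chartInv I x₀) y w') := by
  haveI := g.hasLeviCivita
  haveI := (chartPullback I g x₀).hasLeviCivita
  have h2 : (2 : ℕ∞ω) ≤ ∞ := WithTop.coe_le_coe.mpr le_top
  set L := mfderiv 𝓘(ℝ, E) I (chartInv I x₀) y with hL
  have hLi : L.IsInvertible := isInvertible_mfderiv_of_injective rfl (injective_mfderiv_chartInv x₀ y)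
  have hG := val_chartPullback_eq_chartRep (I := I) (fun _ : ℝ ↦ g) x₀ 0
  rw [← Lorentzian.OpensChart.riemann_eq_riemAt hG y v w z, ← hG y,
    g.riemann_comap_apply contMDiff_pullbackBilin_holds (contMDiff_chartInv x₀)
      (injective_mfderiv_chartInv x₀) rfl y v w z]
  change g.val (chartInv I x₀ y) (L (L.inverse (g.riemann (chartInv I x₀ y) (L v) (L w) (L z)))) (L w') = _
  rw [hLi.self_apply_inverse, PseudoRiemannianMetric.curvatureForm, hLC.curvature_eq_riemann h2]

/-- **`|Rm|² ≥ 0`** for a Riemannian metric and a Levi-Civita connection (a sum of squares in an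
orthonormal frame, `rmNormSqAt_eq_sum_sq`). [cite: Topping2006, §3.2, (3.2.4)] -/
theorem curvNormSqWith_nonneg (hR : g.IsRiemannian) (hLC : g.IsLeviCivita cov) (x₀ : M) :
    0 ≤ g.curvNormSqWith cov x₀ := by
  classical
  have hy₀ : extChartAt I x₀ x₀ ∈ (extChartAt I x₀).target := mem_extChartAt_target x₀
  set y₀ : chartTarget I x₀ := ⟨extChartAt I x₀ x₀, hy₀⟩
  have hΦ : chartInv I x₀ y₀ = x₀ := extChartAt_to_inv x₀
  rw [← hΦ, curvNormSqWith_chartInv_eq' hLC x₀ y₀]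
  have hGm := isMetricOn_chartRep_const g x₀
  obtain ⟨e, he⟩ := MetricCoord.exists_orthonormal_basis (chartRep_const_symm x₀ y₀)
    (chartRep_const_pos hR x₀ y₀)
  exact hGm.rmNormSqAt_nonneg e he hy₀

/-- **Frame bound ⇒ norm bound**: `CurvatureBoundedBy g cov K` (the frame form `|Rm| ≤ K` of
`RicciFlowMaximal.lean`) gives `|Rm|²_g(x) ≤ n⁴ K²`, `n = dim M`. [cite: Topping2006, §3.2, p. 37] -/
theorem curvNormSqWith_le_of_curvatureBoundedBy (hR : g.IsRiemannian) (hLC : g.IsLeviCivita cov)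
    {K : ℝ} (hK : CurvatureBoundedBy g cov K) (x₀ : M) :
    g.curvNormSqWith cov x₀ ≤ (finrank ℝ E : ℝ) ^ 4 * K ^ 2 := by
  classical
  have hy₀ : extChartAt I x₀ x₀ ∈ (extChartAt I x₀).target := mem_extChartAt_target x₀
  set y₀ : chartTarget I x₀ := ⟨extChartAt I x₀ x₀, hy₀⟩
  have hΦ : chartInv I x₀ y₀ = x₀ := extChartAt_to_inv x₀
  rw [← hΦ, curvNormSqWith_chartInv_eq' hLC x₀ y₀]
  have hGm := isMetricOn_chartRep_const g x₀
  obtain ⟨e, he⟩ := MetricCoord.exists_orthonormal_basis (chartRep_const_symm x₀ y₀)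
    (chartRep_const_pos hR x₀ y₀)
  have h := hGm.rmNormSqAt_le_of_frameBound e he hy₀ (K := K) fun v w z w' hv hw hz hw' ↦ by
    rw [chartRep_riemAt_eq_curvatureForm hLC x₀ y₀]
    refine hK _ _ _ _ _ ?_ ?_ ?_ ?_
    · simpa only [chartRep_apply, val_chartPullback_apply] using hv
    · simpa only [chartRep_apply, val_chartPullback_apply] using hw
    · simpa only [chartRep_apply, val_chartPullback_apply] using hz
    · simpa only [chartRep_apply, val_chartPullback_apply] using hw'
  simpa using h

/-- **Norm bound ⇒ frame bound**: if `|Rm|²_g ≤ c` everywhere then `CurvatureBoundedBy g cov √c`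
(Cauchy–Schwarz in an orthonormal frame, `abs_apply_riem_le_sqrt`). [cite: Topping2006, §3.2, p. 37] -/
theorem curvatureBoundedBy_of_curvNormSqWith_le (hR : g.IsRiemannian) (hLC : g.IsLeviCivita cov)
    {c : ℝ} (hc : ∀ x, g.curvNormSqWith cov x ≤ c) : CurvatureBoundedBy g cov (Real.sqrt c) := by
  classical
  intro x₀
  have hy₀ : extChartAt I x₀ x₀ ∈ (extChartAt I x₀).target := mem_extChartAt_target x₀
  set y₀ : chartTarget I x₀ := ⟨extChartAt I x₀ x₀, hy₀⟩
  have hΦ : chartInv I x₀ y₀ = x₀ := extChartAt_to_inv x₀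
  -- it suffices to prove the bound at the point `chartInv y₀ (= x₀)`
  suffices h : ∀ X Y Z W : TangentSpace I (chartInv I x₀ y₀),
      g.val (chartInv I x₀ y₀) X X ≤ 1 → g.val (chartInv I x₀ y₀) Y Y ≤ 1 →
      g.val (chartInv I x₀ y₀) Z Z ≤ 1 → g.val (chartInv I x₀ y₀) W W ≤ 1 →
      |g.curvatureForm cov (chartInv I x₀ y₀) X Y Z W| ≤ Real.sqrt c by
    rw [← hΦ]
    exact h
  intro X Y Z W hX hY hZ hW
  have hGm := isMetricOn_chartRep_const g x₀
  obtain ⟨e, he⟩ := MetricCoord.exists_orthonormal_basis (chartRep_const_symm x₀ y₀)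
    (chartRep_const_pos hR x₀ y₀)
  set L := mfderiv 𝓘(ℝ, E) I (chartInv I x₀) y₀ with hL
  have hLi : L.IsInvertible := isInvertible_mfderiv_of_injective rfl (injective_mfderiv_chartInv x₀ y₀)
  have hv : L (L.inverse X) = X := hLi.self_apply_inverse X
  have hw : L (L.inverse Y) = Y := hLi.self_apply_inverse Y
  have hz : L (L.inverse Z) = Z := hLi.self_apply_inverse Z
  have hw' : L (L.inverse W) = W := hLi.self_apply_inverse W
  have key := hGm.abs_apply_riem_le_sqrt e he hy₀ (L.inverse X) (L.inverse Y) (L.inverse Z) (L.inverse W)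
    (by rw [chartRep_apply, val_chartPullback_apply, ← hL, hv]; exact hX)
    (by rw [chartRep_apply, val_chartPullback_apply, ← hL, hw]; exact hY)
    (by rw [chartRep_apply, val_chartPullback_apply, ← hL, hz]; exact hZ)
    (by rw [chartRep_apply, val_chartPullback_apply, ← hL, hw']; exact hW)
  rw [chartRep_riemAt_eq_curvatureForm hLC x₀ y₀, ← curvNormSqWith_chartInv_eq' hLC x₀ y₀, ← hL,
    hv, hw, hz, hw'] at key
  exact key.trans (Real.sqrt_le_sqrt (hc _))

end Pointwise

/-! ### Joint smoothness along a Ricci flow -/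

section Smoothness

variable {E : Type*} [NormedAddCommGroup E] [NormedSpace ℝ E] [FiniteDimensional ℝ E]
  [CompleteSpace E] {H : Type*} [TopologicalSpace H] {I : ModelWithCorners ℝ E H} [I.Boundaryless]
  {M : Type*} [TopologicalSpace M] [ChartedSpace H M] [IsManifold I ∞ M]
  {g : ℝ → PseudoRiemannianMetric I ∞ E (TangentSpace I : M → Type _)}
  {cov : ℝ → CovariantDerivative I E (TangentSpace I : M → Type _)} {T : ℝ}

/-- **Along a Ricci flow on `[0, T]`, `(x, t) ↦ |Rm|²(x, t)` is `C^∞` on `M × [0, T]`**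
(Topping 2006, §1.2.3: the curvature of a smooth family is smooth on space-time): in the chart at
`z` the function is `rmNormSqAt (chartRep I g z t) (chart x)`, jointly smooth by
`IsMetricFamilyOn.contDiffOn_rmNormSqAt_family`. [cite: Topping2006, §1.2.3] -/
theorem IsRicciFlow.contMDiffOn_curvNormSqWith (hflow : IsRicciFlow g cov (Icc 0 T))
    (hfam : ∀ z : M, ContDiffOn ℝ ∞ (fun q : E × ℝ ↦ MetricCoord.rmNormSqAt (chartRep I g z q.2) q.1)
      ((extChartAt I z).target ×ˢ Icc 0 T)) :
    ContMDiffOn (I.prod 𝓘(ℝ, ℝ)) 𝓘(ℝ, ℝ) ∞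
      (fun p : M × ℝ ↦ (g p.2).curvNormSqWith (cov p.2) p.1) (univ ×ˢ Icc 0 T) := by
  intro p hp
  obtain ⟨x, t⟩ := p
  have ht : t ∈ Icc 0 T := hp.2
  -- work in the chart at `x`
  set z := x
  have hΦ : ContMDiffOn (I.prod 𝓘(ℝ, ℝ)) 𝓘(ℝ, E × ℝ) ∞ (fun p : M × ℝ ↦ (extChartAt I z p.1, p.2))
      ((chartAt H z).source ×ˢ Icc 0 T) :=
    ((contMDiffOn_extChartAt (x := z)).comp contMDiffOn_fst fun p hp ↦ hp.1).prodMk_space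
      contMDiffOn_snd
  have hmaps : MapsTo (fun p : M × ℝ ↦ (extChartAt I z p.1, p.2)) ((chartAt H z).source ×ˢ Icc 0 T)
      ((extChartAt I z).target ×ˢ Icc 0 T) := by
    intro p hp
    refine ⟨(extChartAt I z).map_source ?_, hp.2⟩
    rw [extChartAt_source]
    exact hp.1
  have hcomp := (contMDiffOn_iff_contDiffOn.2 (hfam z)).comp hΦ hmaps
  have hnhds : (chartAt H z).source ×ˢ Icc 0 T ∈ 𝓝[univ ×ˢ Icc 0 T] ((x, t) : M × ℝ) := by
    refine mem_nhdsWithin.mpr ⟨(chartAt H z).source ×ˢ univ,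
      (chartAt H z).open_source.prod isOpen_univ, ⟨mem_chart_source H z, mem_univ _⟩, ?_⟩
    rintro q ⟨⟨hq1, -⟩, ⟨-, hq2⟩⟩
    exact ⟨hq1, hq2⟩
  have hxz : (x, t) ∈ (chartAt H z).source ×ˢ Icc 0 T := ⟨mem_chart_source H z, ht⟩
  refine ((hcomp.congr fun q hq ↦ ?_) (x, t) hxz).mono_of_mem_nhdsWithin hnhds
  -- the chart identity
  have hq1 : q.1 ∈ (chartAt H z).source := hq.1
  have hy : extChartAt I z q.1 ∈ (extChartAt I z).target :=
    (extChartAt I z).map_source (by rw [extChartAt_source]; exact hq1)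
  have hinv : chartInv I z ⟨extChartAt I z q.1, hy⟩ = q.1 :=
    (extChartAt I z).left_inv (by rw [extChartAt_source]; exact hq1)
  simp only [Function.comp_apply]
  rw [← curvNormSqWith_chartInv_eq (hflow.isLeviCivita q.2 hq.2) z ⟨extChartAt I z q.1, hy⟩, hinv]

end Smoothness

end Literature.Geometry.Riemannian

end
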